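import Summits.ABC.IUTFork.Joshi.AdelicAnsatzPeriod
import HarnessLib

/-!
# Joshi, ATS III §4.6 (cont.): Thm. 4.6.1 (4) and Rmk. 4.6.2 — what the `j²`-scaling of the Θ^{gau}-link forces on
# normalizations and on the period hyperplanes (block E, slot T-08, OBJECTS.tsv O-020; file 3 of 3)

Record-only typing (D-0012) of K. Joshi, *Construction of Arithmetic Teichmüller Spaces III*, arXiv:2401.13508v4
(«[J-III]», unrefereed), §4.6 p.37 l.19–26 (Thm. 4.6.1 (4)) and p.37 l.46–p.38 l.17 (Rmk. 4.6.2), over the carrier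
`ArithPeriodDatum` of `Joshi/AdelicAnsatzPeriod.lean`; upstream [J-IIh] = arXiv:2305.10398 ("[Joshi, 2023a]").
The valuation-scaling relation of [J-III] Thm. 4.2.2.1 (4)–(5) ((4.2.2.2)/(4.2.2.3), p.33 l.3–44) — slot T-07's
claim of record, `Joshi.AdelicCurveDatum.ValuationScaling` / `ValuationConstantOffSS` in the LANDED
`Joshi/AdelicAnsatz.lean` (stated on a common evaluation domain `T p_w`) — enters ONLY as the hypothesis
predicates `ScalingOnL` / `DiagonalOnL` (the same relations restricted to the image of `L′` in the residue
fields, the instance Thm. 4.6.1 consumes; merge-debt: derive them from T-07's once the carriers are reconciled);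
nothing is asserted. What print states in
prose is PROVED here over the signature, conditionally on those predicates:
* `renormalization_forced` — Thm. 4.6.1 (4) / Cor. 4.2.2.4 ("the local valuations … at primes of non-semistable
  reduction must also be suitably (re)normalized so that the product formula holds"), contrapositive form;
* `alpha_scaling`, `alpha_eq_off_bad` — Rmk. 4.6.2 (4) ("the hyperplane `H_{y_j}` comes equipped with a scaling
  factor of `j²` (for appropriate coordinate `v`)") as `j² · α_{y_j,w} = α_{y_1,w}` on `V^{odd,ss}`, `α_{y_j,w} = α_{y_1,w}`
  off it, under standard normalization ([J-IIh] (5.3.3));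
* `hyperplane_first_ne` — a proved instance of Thm. 4.6.1 (6) "non-constant" along ONE Ansatz point:
  `H_{y_1} ≠ H_{y_j}` (`j ≥ 2`).
Rmk. 4.6.2 (1)–(3) and the attach points of (4) ([IUTchIII] Cor. 3.12; [Scholze–Stix 2018, §2.2 p.10]; the
realified Frobenioids `Frob(L)^ℝ_j` ↔ OUR `Summit.ABC.IUTFork.Thm311.GlobalDegrees` / `DegreesViaLogvol`,
dictionary-support row D-12 of plan/E/E-PLAN.md) are LOCATORS in the docstring of `alpha_scaling` — located, not
adjudicated, not bound (E-PLAN R14: no `Cor312*`/`Thm311*` import here). TAKES NO SIDE on [IUTchIII] Cor. 3.12 or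
on any author; typed ≠ proved; our honest-`j²` pinned countermodel `Cor312Vol.PinnedWitness.pinned_countermodel`
carries the same exponent law on the Θ-side (located only). Inputs ⊆ Mathlib; standard axioms only; sorry-free.
Seat abc-iut-E-t8 (rung LADDER-ABC:A2.E).
-/

noncomputable section

open Set Filter

namespace Summit.ABC.IUTFork.Joshi

namespace ArithPeriodDatum

variable {L : Type} [Field L] (D : ArithPeriodDatum L)

/-! ### Thm. 4.6.1 (4) and Rmk. 4.6.2 (4): what the `j²`-scaling forces -/

/-- **[J-III] Thm. 4.2.2.1 (4), (4.2.2.2) (p.33 l.3–36), RESTRICTED TO `L′`** (the instance Thm. 4.6.1 (4) consumes):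
"for each `w ∈ V^{odd,ss}` … `|−|_{K_{y′_{w,j}}} = |−|^{j²}_{K_{y′_{w,1}}}` for `j = 1, …, ℓ⋇`", read on the images of `x ∈ L′`.
T-07's claim-Prop (file `Joshi/AdelicAnsatz.lean`) is the statement of record; here a HYPOTHESIS predicate of the
theorems below, never asserted. Our honest-`j²` pinned countermodel `Cor312Vol.PinnedWitness.pinned_countermodel`
carries the same exponent law on the Θ-side (located, not bound). [claim: Joshi2024ATS3, status: disputed] -/
def ScalingOnL (z : D.Tuple) : Prop :=
  ∀ w ∈ D.Voddss, ∀ (i : Fin D.lstar) (x : L),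
    D.abs w (z i w) (D.emb w (z i w) x) = (D.abs w (z D.first w) (D.emb w (z D.first w) x)) ^ (D.jOf i ^ 2)

/-- **[J-III] Thm. 4.2.2.1 (5), (4.2.2.3) (p.33 l.37–44), RESTRICTED TO `L′`**: "for each `w ∈ V_{L′} − V^{odd,ss}` …
`|−|_{K_{y′_{w,j}}} = |−|_{K_{y′_{w,1}}}`". HYPOTHESIS predicate (T-07's claim of record; it follows from the diagonal clause
of Def. 4.2.2, `diagonalOnL_of_isDiagonalOffBad`). [claim: Joshi2024ATS3, status: disputed] -/
def DiagonalOnL (z : D.Tuple) : Prop :=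
  ∀ w, w ∉ D.Voddss → ∀ (i : Fin D.lstar) (x : L),
    D.abs w (z i w) (D.emb w (z i w) x) = D.abs w (z D.first w) (D.emb w (z D.first w) x)

/-- (4.2.2.3) on `L′` from the diagonal clause of Def. 4.2.2 — PROVED ("The last assertion is immediate from the
definition of `Σ̃_{L′}`", p.33 l.76). [folklore] -/
theorem diagonalOnL_of_isDiagonalOffBad {z : D.Tuple} (hz : D.IsDiagonalOffBad z) : D.DiagonalOnL z := by
  intro w hw i x
  rw [hz w hw i]

open Classical in
/-- **[J-III] Thm. 4.6.1 (4) (p.37 l.19–26) / Cor. 4.2.2.4 (p.33 l.81–p.34 l.11) — PROVED over the signature, in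
contrapositive form.** Print: "The scaling of valuations by the factor `j²` at primes of semi-stable reduction …
together with the requirement that the global product formula holds for `arith(L)^nor_{y_j}`, means that the local
valuations … at primes of non-semistable reduction must also be suitably (re)normalized so that the product
formula holds (this is given to us by Corollary 4.2.2.4)." Typed: if `y_1` and `y_j` (`j ≥ 2`) of a tuple with the
scaling (4.2.2.2) on `V^{odd,ss}` and (4.2.2.3) off it are BOTH normalized with the SAME normalization coordinate
(no renormalization anywhere), then every `x ∈ L′^*` has `Σ_{w ∈ V^{odd,ss}} α_w · log|x|_{K_{y_1,w}} = 0` — i.e. `L′^*`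
is `α`-degree-zero on `V^{odd,ss}` alone (absurd for a number field and a nonempty finite set of finite places:
that last step is number theory, not asserted here). [folklore] -/
theorem renormalization_forced {z : D.Tuple} (hsc : D.ScalingOnL z) (hdiag : D.DiagonalOnL z)
    {i : Fin D.lstar} (hi : i ≠ D.first) (h1 : D.IsNormalized (z D.first)) (hj : D.IsNormalized (z i))
    (hα : D.α (z i) = D.α (z D.first)) (x : Lˣ) :
    D.degFunctional (z D.first)
      ((D.logMap (z D.first) (D.embIdeloid (z D.first) x)).filter (· ∈ D.Voddss)) = 0 := by
  set a := D.logMap (z D.first) (D.embIdeloid (z D.first) x) with ha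
  set b := D.logMap (z i) (D.embIdeloid (z i) x) with hb
  -- coordinatewise comparison of the two logarithm vectors
  have hcoord : ∀ w, b w = if w ∈ D.Voddss then ((D.jOf i : ℝ) ^ 2) * a w else a w := by
    intro w
    by_cases hw : w ∈ D.Voddss
    · rw [if_pos hw, hb, ha, logMap_apply, logMap_apply]
      simp only [embIdeloid, embUnits_apply]
      rw [hsc w hw i (x : L), Real.log_pow]; push_cast; ring
    · rw [if_neg hw, hb, ha, logMap_apply, logMap_apply]
      simp only [embIdeloid, embUnits_apply]
      rw [hdiag w hw i (x : L)]
  -- `b - a = (j² - 1) • a|_{V^{odd,ss}}`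
  have hdiff : b - a = (((D.jOf i : ℝ) ^ 2) - 1) • a.filter (· ∈ D.Voddss) := by
    ext w
    simp only [Finsupp.coe_sub, Pi.sub_apply, Finsupp.coe_smul, Pi.smul_apply, Finsupp.filter_apply,
      smul_eq_mul, hcoord w]
    split_ifs <;> ring
  -- both degrees vanish, with the same functional
  have hda : D.degFunctional (z D.first) a = 0 := h1 x
  have hdb : D.degFunctional (z D.first) b = 0 := by
    have := hj x; simp only [deg] at this; rwa [show D.degFunctional (z i) = D.degFunctional (z D.first) by
      simp only [degFunctional, hα]] at this
  have hd : D.degFunctional (z D.first) (b - a) = 0 := by rw [map_sub, hda, hdb, sub_zero]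
  rw [hdiff, map_smul, smul_eq_mul, mul_eq_zero] at hd
  rcases hd with h | h
  · exfalso
    have h2 : (2 : ℝ) ≤ D.jOf i := by exact_mod_cast D.two_le_jOf hi
    nlinarith
  · exact h

/-- **[J-III] Rmk. 4.6.2 (4) (p.38 l.9–17), "the hyperplane `H_{y_j}` comes equipped with a scaling factor of `j²`
(for appropriate coordinate `v ∈ V_L` depending on the semi-stable elliptic curve)" — PROVED over the signature**
as the relation between normalization coordinates: if `y_1` and `y_j` are both normalized TO THE STANDARD absolute
values ([J-IIh] (5.3.3)) and the scaling (4.2.2.2) holds at `w ∈ V^{odd,ss}`, and some `x ∈ L′^*` is not a `|−|_w`-unit,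
then `j² · α_{y_j,w} = α_{y_1,w}`. The rest of Rmk. 4.6.2 (4) — "vital to establishing [IUTchIII] Cor. 3.12 … claimed
without proof in [IUTchIII], [Tan, 2018], [Yamashita, 2019] … leads to the assertions of impossibility of this
phenomenon in [Scholze and Stix, 2018, Section 2.2, Page 10]" — is an attach-point LOCATOR only (no Prop, no side
taken); likewise Rmk. 4.6.2 (1) ("I expect that the above period mapping is continuous"), (2) (Mochizuki on product
formulas: [IUTchIII] Rmk. 3.9.6, [IUTchI] Rmk. 5.2.1), (3) ("Mochizuki considers (without a transparent proof) a
version of this construction by means of the realified Frobenioid … the tuple `(Frob(L)^ℝ_1, …, Frob(L)^ℝ_{ℓ⋇})` which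
provides, by the same degree mapping, the hyperplanes considered here" — dictionary-support row D-12: OUR
`Summit.ABC.IUTFork.Thm311.GlobalDegrees` / `DegreesViaLogvol`, not bound in this file). [folklore] -/
theorem alpha_scaling {z : D.Tuple} (hsc : D.ScalingOnL z) {i : Fin D.lstar}
    (h1 : D.IsStdNormalized (z D.first)) (hj : D.IsStdNormalized (z i)) {w : D.V} (hw : w ∈ D.Voddss)
    {x : L} (hx0 : x ≠ 0) (hx1 : D.stdAbs w x ≠ 1) :
    ((D.jOf i : ℝ) ^ 2) * D.α (z i) w = D.α (z D.first) w := by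
  set r := D.abs w (z D.first w) (D.emb w (z D.first w) x) with hr
  have hrpos : 0 < r := (D.abs w _).pos (by simpa using (D.emb w (z D.first w)).injective.ne hx0)
  -- `r ^ α₁ = |x|_w = (r ^ j²) ^ α_j`
  have hstd1 : r ^ (D.α (z D.first) w) = D.stdAbs w x := h1 w x
  have hstdj : (r ^ (D.jOf i ^ 2)) ^ (D.α (z i) w) = D.stdAbs w x := by rw [← hsc w hw i x]; exact hj w x
  have hlog1 : Real.log (D.stdAbs w x) = D.α (z D.first) w * Real.log r := by
    rw [← hstd1, Real.log_rpow hrpos]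
  have hlogj : Real.log (D.stdAbs w x) = D.α (z i) w * ((D.jOf i : ℝ) ^ 2 * Real.log r) := by
    rw [← hstdj, Real.log_rpow (pow_pos hrpos _), Real.log_pow]; push_cast; ring
  -- `log r ≠ 0` since `|x|_w ≠ 1`, `|x|_w > 0`
  have hr1 : Real.log r ≠ 0 := by
    intro h0
    apply hx1
    rw [← hstd1]
    rcases Real.log_eq_zero.1 h0 with h | h | h
    · exact absurd h hrpos.ne'
    · rw [h, Real.one_rpow]
    · linarith
  have := hlog1.symm.trans hlogj
  have hmul : (D.α (z D.first) w - (D.jOf i : ℝ) ^ 2 * D.α (z i) w) * Real.log r = 0 := by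
    rw [sub_mul]; linarith
  rcases mul_eq_zero.1 hmul with h | h
  · linarith
  · exact absurd h hr1

/-- Off `V^{odd,ss}`, standard normalization of `y_1` and `y_j` and (4.2.2.3) give EQUAL coordinates — PROVED. [folklore] -/
theorem alpha_eq_off_bad {z : D.Tuple} (hdiag : D.DiagonalOnL z) {i : Fin D.lstar}
    (h1 : D.IsStdNormalized (z D.first)) (hj : D.IsStdNormalized (z i)) {w : D.V} (hw : w ∉ D.Voddss)
    {x : L} (hx0 : x ≠ 0) (hx1 : D.stdAbs w x ≠ 1) : D.α (z i) w = D.α (z D.first) w := by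
  set r := D.abs w (z D.first w) (D.emb w (z D.first w) x) with hr
  have hrpos : 0 < r := (D.abs w _).pos (by simpa using (D.emb w (z D.first w)).injective.ne hx0)
  have hstd1 : r ^ (D.α (z D.first) w) = D.stdAbs w x := h1 w x
  have hstdj : r ^ (D.α (z i) w) = D.stdAbs w x := by rw [hr, ← hdiag w hw i x]; exact hj w x
  have hr1 : Real.log r ≠ 0 := by
    intro h0
    apply hx1
    rw [← hstd1]
    rcases Real.log_eq_zero.1 h0 with h | h | h
    · exact absurd h hrpos.ne'
    · rw [h, Real.one_rpow]
    · linarith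
  have := congrArg Real.log (hstdj.trans hstd1.symm)
  rw [Real.log_rpow hrpos, Real.log_rpow hrpos] at this
  exact mul_right_cancel₀ hr1 this

/-- **A proved instance of Thm. 4.6.1 (6) "non-constant" / Rmk. 4.6.2 (4) along ONE Ansatz point**: under the scaling
(4.2.2.2)/(4.2.2.3) and standard normalization of `y_1` and `y_j` (`j ≥ 2`), if `V^{odd,ss}` contains a place `w₀` and
its complement a place `w₁` at each of which some element of `L′^*` is not a unit, then `H_{y_1} ≠ H_{y_j}`: the
components of the period tuple `(H_{y_1}, …, H_{y_{ℓ⋇}})` of `z` are distinct hyperplanes (the hyperplane "moves"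
along the Θ^{gau}-link, [J-III] (1.7.1) p.12 l.21–35). Conditional on T-07's scaling claim; no side taken on the
print dispute the docstring of `PeriodMapNonconstant` locates. Witness: `α_{1,w₁}·e_{w₀} − α_{1,w₀}·e_{w₁} ∈ H_{y_1} ∖ H_{y_j}`.
[folklore] -/
theorem hyperplane_first_ne {z : D.Tuple} (hsc : D.ScalingOnL z) (hdiag : D.DiagonalOnL z)
    {i : Fin D.lstar} (hi : i ≠ D.first) (h1 : D.IsStdNormalized (z D.first)) (hj : D.IsStdNormalized (z i))
    {w₀ w₁ : D.V} (hw₀ : w₀ ∈ D.Voddss) (hw₁ : w₁ ∉ D.Voddss)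
    (hx₀ : ∃ x : L, x ≠ 0 ∧ D.stdAbs w₀ x ≠ 1) (hx₁ : ∃ x : L, x ≠ 0 ∧ D.stdAbs w₁ x ≠ 1) :
    D.hyperplane (z D.first) ≠ D.hyperplane (z i) := by
  obtain ⟨x₀, hx₀0, hx₀1⟩ := hx₀
  obtain ⟨x₁, hx₁0, hx₁1⟩ := hx₁
  have hne : w₀ ≠ w₁ := fun h => hw₁ (h ▸ hw₀)
  have e0 : ((D.jOf i : ℝ) ^ 2) * D.α (z i) w₀ = D.α (z D.first) w₀ := D.alpha_scaling hsc h1 hj hw₀ hx₀0 hx₀1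
  have e1 : D.α (z i) w₁ = D.α (z D.first) w₁ := D.alpha_eq_off_bad hdiag h1 hj hw₁ hx₁0 hx₁1
  set a₀ := D.α (z D.first) w₀
  set a₁ := D.α (z D.first) w₁
  have ha₀ : 0 < a₀ := D.α_pos _ _
  have ha₁ : 0 < a₁ := D.α_pos _ _
  -- the witness vector
  set l : D.V →₀ ℝ := Finsupp.single w₀ a₁ - Finsupp.single w₁ a₀ with hl
  have hl1 : l ∈ D.hyperplane (z D.first) := by
    rw [hyperplane, LinearMap.mem_ker, hl, map_sub, degFunctional_single, degFunctional_single]; ring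
  intro hH
  have hlj : l ∈ D.hyperplane (z i) := hH ▸ hl1
  rw [hyperplane, LinearMap.mem_ker, hl, map_sub, degFunctional_single, degFunctional_single, e1] at hlj
  -- `a₁ · α_{j,w₀} = a₀ · a₁` with `j² α_{j,w₀} = a₀` forces `j² = 1`
  have hj2 : (2 : ℝ) ≤ D.jOf i := by exact_mod_cast D.two_le_jOf hi
  have hαj : D.α (z i) w₀ = a₀ := by
    have : a₁ * (D.α (z i) w₀ - a₀) = 0 := by rw [mul_sub]; linarith
    rcases mul_eq_zero.1 this with h | h
    · exact absurd h ha₁.ne'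
    · linarith
  rw [hαj] at e0
  have hsq : ((D.jOf i : ℝ) ^ 2 - 1) * a₀ = 0 := by rw [sub_mul, one_mul, e0, sub_self]
  rcases mul_eq_zero.1 hsq with h | h
  · nlinarith
  · exact absurd h ha₀.ne'

end ArithPeriodDatum

end Summit.ABC.IUTFork.Joshi

-- build-enqueue re-land 2026-08-26T07:47Z (comment only; all declarations byte-identical; stranded-accept remedy, cf. HOME/OPS-REQUESTS 07:42:41Z pattern)
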